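import Literature.Geometry.Riemannian.GreatSphereFibrationHomogeneous
import Literature.Geometry.Manifold.InverseFunctionTheorem
import HarnessLib

/-!
# The affine charts of the base of a great-sphere fibration (Hähl 1987, 2.9) are smooth immersions

Third file of the proof programme for the corrected form of
`Literature.Geometry.Riemannian.Hahl1987_greatSphereFibration_base_sphere` (H. Hähl, Results
Math. 12 (1987) 99–118, Prop. 4.7), after `GreatSphereFibrationSpread.lean` (2.1, set theory) and
`GreatSphereFibrationHomogeneous.lean` (the homogeneous extension `𝒫 = p ∘ unitVec` and the
kernel of its differential).

* `IsGreatSphereSubmersion d k p` bundles the standing hypotheses of Hähl's theorem in the form of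
  the tree's fact: `p : S(E) → M` (`dim E = d + 1 = 2k`, `M` a `k`-manifold) is a `C^∞` surjective
  submersion all of whose fibres are great `(k-1)`-spheres `S(E) ∩ V`, `dim V = k` — by
  Ehresmann's theorem the same thing as Hähl's "locally trivial differentiable fibre bundle with
  total space `S²ᵏ⁻¹` whose fibres are great `(k-1)`-spheres" (p. 99).
* `baseChart p x₀ x J : ℝᵏ → M`, `c ↦ 𝒫 (x + J c)` — **Hähl's affine chart 2.9** of the base
  centred at the fibre of `x`, with coordinates in a fibre subspace `W = V_w` framed by a linear
  isomorphism `J : ℝᵏ ≃ W` (Hähl: `a ↦ U_a`, the fibre subspace through `(e, a)`; here `x` need not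
  lie in a fibre subspace complementary to `W`, only `x ∉ W`, and `J` need not be isometric). It
  misses the point `∞ = p w` (`baseChart_ne`), is injective (`baseChart_injective`), attains every
  other point (`exists_baseChart_eq`, `range_baseChart`), is `C^∞` (`contMDiff_baseChart`), and —
  the new analytic content, from `ker d𝒫_v = V_{v/‖v‖}` — has injective differential everywhere
  (`mfderiv_baseChart_injective`), hence is a local diffeomorphism at every point by the inverse
  function theorem on manifolds (`isLocalDiffeomorphAt_baseChart`, tree theorem
  `Literature.Geometry.Manifold.isLocalDiffeomorphAt_of_mfderiv`) and an open map. This is Hähl's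
  2.7/2.9 ("the base space … endowed with the differentiable structure which makes `ψ_∞`, `ψ₀`
  diffeomorphisms"; here the smooth structure of `M` is given and the charts are PROVED to be local
  diffeomorphisms onto the open set `M ∖ {∞}`).

Everything is proved; definitions: the hypothesis structure, the explicit chart, and its
differential as an equivalence. No named facts.

## References

* [Hahl1987] H. Hähl, Results Math. 12 (1987) 99–118 — §1 p. 99 (setting), 2.1, 2.7, 2.9.
* J. M. Lee, *Introduction to Smooth Manifolds* (2013), Thm. 4.5 (inverse function theorem).
-/

noncomputable section

open Set Function Module Submodule Metric
open scoped Manifold ContDiff Topology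

namespace Literature.Geometry.Riemannian

variable {E : Type*} [NormedAddCommGroup E] [InnerProductSpace ℝ E] {M : Type*}

/-! ### The standing hypotheses -/

section Structure

variable (d k : ℕ) [Fact (finrank ℝ E = d + 1)] [TopologicalSpace M]
  [ChartedSpace (EuclideanSpace ℝ (Fin k)) M]

/-- **A smooth great-sphere fibration, as a surjective submersion.** `p : S(E) → M` is a `C^∞`
surjective submersion of the unit sphere of `E`, `dim E = 2k` (so `S(E) = S²ᵏ⁻¹`, of dimension
`d = 2k - 1`), onto the `k`-manifold `M`, each of whose fibres is a great `(k-1)`-sphere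
`p ⁻¹' {p x} = S(E) ∩ V`, `dim V = k` (binder typed by the sphere). This is the hypothesis list of
the (corrected) tree fact `Hahl1987_greatSphereFibration_base_sphere` (`E = ℝ⁸`, `k = 4`); by
Ehresmann's theorem it is Hähl's "locally trivial differentiable fibre bundle with total space
`S²ⁿ⁻¹` whose fibres are great `(n-1)`-spheres" with base `B(π) ≅ M`. [cite: Hahl1987, §1 (p. 99) and Thm. 1.3] -/
structure IsGreatSphereSubmersion (p : sphere (0 : E) 1 → M) : Prop where
  /-- the total space has dimension `2k` -/
  finrank_eq : finrank ℝ E = 2 * k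
  /-- `p` is smooth -/
  contMDiff : ContMDiff (𝓡 d) (𝓡 k) ∞ p
  /-- `p` is onto -/
  surjective : Surjective p
  /-- `p` is a submersion -/
  mfderiv_surjective : ∀ x, Surjective (mfderiv (𝓡 d) (𝓡 k) p x)
  /-- every fibre is a great sphere `S(E) ∩ V`, `dim V = k` -/
  exists_fibre : ∀ x, ∃ V : Submodule ℝ E, finrank ℝ V = k ∧
    p ⁻¹' {p x} = {y : sphere (0 : E) 1 | (y : E) ∈ V}

end Structure

variable {k : ℕ} {p : sphere (0 : E) 1 → M} {x₀ : sphere (0 : E) 1}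

/-! ### The affine chart of the base -/

/-- **Hähl's affine chart of the base** (2.9), lifted through the homogeneous extension:
`baseChart p x₀ x J c = 𝒫 (x + J c) = p ((x + J c)/‖x + J c‖)`, the fibre through the point `x + J c`
of the affine subspace `x + W`, where `W = V_w` is a fibre subspace framed by `J : ℝᵏ ≃ W` and
`x ∉ W` (Hähl: `W = U∞ = {0} × ℝⁿ`, `x = (e, 0)`, chart `a ↦ U_a ∋ (e, a)`). Junk (the value `p x₀`)
only where `x + J c = 0`, which never happens for `x ∉ W`. [cite: Hahl1987, 2.9] -/
def baseChart (p : sphere (0 : E) 1 → M) (x₀ : sphere (0 : E) 1) (x : E) {w : sphere (0 : E) 1}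
    (J : EuclideanSpace ℝ (Fin k) ≃L[ℝ] fibreSpan p w) (c : EuclideanSpace ℝ (Fin k)) : M :=
  coneExtension p x₀ (x + (J c : E))

variable {w : sphere (0 : E) 1} (J : EuclideanSpace ℝ (Fin k) ≃L[ℝ] fibreSpan p w) {x : E}

/-- Unfolding of the chart. [folklore] -/
theorem baseChart_apply (c : EuclideanSpace ℝ (Fin k)) :
    baseChart p x₀ x J c = coneExtension p x₀ (x + (J c : E)) := rfl

/-- The points `x + J c` of the affine subspace are non-zero when `x ∉ W`. [folklore] -/
theorem add_frame_ne_zero (hx : x ∉ fibreSpan p w) (c : EuclideanSpace ℝ (Fin k)) :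
    x + (J c : E) ≠ 0 := by
  intro h
  apply hx
  have : x = -(J c : E) := eq_neg_of_add_eq_zero_left h
  rw [this]
  exact neg_mem (J c).2

/-- … and they do not lie in `W`. [folklore] -/
theorem add_frame_notMem (hx : x ∉ fibreSpan p w) (c : EuclideanSpace ℝ (Fin k)) :
    x + (J c : E) ∉ fibreSpan p w := by
  intro h
  apply hx
  simpa using sub_mem h (J c).2

/-- The differential of the affine map `c ↦ x + J c` is `J` (followed by the inclusion of `W`).
[folklore] -/
theorem mfderiv_add_frame (x : E) (c : EuclideanSpace ℝ (Fin k)) :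
    mfderiv 𝓘(ℝ, EuclideanSpace ℝ (Fin k)) 𝓘(ℝ, E)
        (fun c : EuclideanSpace ℝ (Fin k) => x + ((J c : fibreSpan p w) : E)) c =
      (fibreSpan p w).subtypeL.comp J.toContinuousLinearMap := by
  have h : HasFDerivAt (fun c : EuclideanSpace ℝ (Fin k) => x + ((J c : fibreSpan p w) : E))
      ((fibreSpan p w).subtypeL.comp J.toContinuousLinearMap) c :=
    (((fibreSpan p w).subtypeL.comp J.toContinuousLinearMap).hasFDerivAt).const_add x
  rw [mfderiv_eq_fderiv, h.fderiv]

/-- **The chart is smooth** (composition of the smooth `𝒫` on `E ∖ 0` with the affine map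
`c ↦ x + J c`, which avoids `0`), for a smooth `p` into any manifold. [cite: Hahl1987, 2.9] -/
theorem contMDiff_baseChart {d : ℕ} [Fact (finrank ℝ E = d + 1)] {m : WithTop ℕ∞} {E' H' : Type*}
    [NormedAddCommGroup E'] [NormedSpace ℝ E'] [TopologicalSpace H'] {I' : ModelWithCorners ℝ E' H'}
    [TopologicalSpace M] [ChartedSpace H' M] (hq : ContMDiff (𝓡 d) I' m p)
    (hx : x ∉ fibreSpan p w) :
    ContMDiff 𝓘(ℝ, EuclideanSpace ℝ (Fin k)) I' m (baseChart p x₀ x J) := by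
  intro c
  have hA : ContMDiff 𝓘(ℝ, EuclideanSpace ℝ (Fin k)) 𝓘(ℝ, E) m
      (fun c : EuclideanSpace ℝ (Fin k) => x + ((J c : fibreSpan p w) : E)) :=
    (contDiff_const.add (((fibreSpan p w).subtypeL.comp J.toContinuousLinearMap).contDiff)).contMDiff
  exact (contMDiffAt_coneExtension hq (add_frame_ne_zero J hx c)).comp c (hA c)

section WithHyp

variable {d : ℕ} [Fact (finrank ℝ E = d + 1)] [TopologicalSpace M]
  [ChartedSpace (EuclideanSpace ℝ (Fin k)) M] (hp : IsGreatSphereSubmersion d k p)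

namespace IsGreatSphereSubmersion

include hp

/-- `0 < k`: the sphere is nonempty (`E ≠ 0` as `dim E = d + 1`), and `dim E = 2k`. [folklore] -/
theorem pos : 0 < k := by
  have h1 : finrank ℝ E = d + 1 := Fact.out
  have h2 := hp.finrank_eq
  omega

/-- The total space is finite-dimensional. [folklore] -/
theorem finiteDimensional : FiniteDimensional ℝ E :=
  Module.finite_of_finrank_pos (by rw [hp.finrank_eq]; have := hp.pos; omega)

/-- Distinct fibre subspaces are complementary (Hähl 2.1: the spread). [cite: Hahl1987, 2.1] -/
theorem isCompl {x y : sphere (0 : E) 1} (h : p x ≠ p y) :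
    IsCompl (fibreSpan p x) (fibreSpan p y) :=
  haveI := hp.finiteDimensional
  isCompl_fibreSpan hp.exists_fibre hp.finrank_eq h

end IsGreatSphereSubmersion

include hp

/-- **The chart misses `∞`**: `baseChart c ≠ p w` (else `x + J c ∈ V_w = W`). [cite: Hahl1987, 2.9] -/
theorem baseChart_ne (hx : x ∉ fibreSpan p w) (c : EuclideanSpace ℝ (Fin k)) :
    baseChart p x₀ x J c ≠ p w := by
  intro h
  rw [baseChart_apply, ← coneExtension_coe (p := p) (x₀ := x₀) w,
    coneExtension_eq_iff hp.exists_fibre _ (add_frame_ne_zero J hx c), unitVec_coe] at h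
  exact add_frame_notMem J hx c h

/-- The fibre subspace of a chart point is not `W`, hence meets `W` only in `0`. [cite: Hahl1987, 2.1] -/
theorem disjoint_fibreSpan_unitVec_add (hx : x ∉ fibreSpan p w) (c : EuclideanSpace ℝ (Fin k)) :
    Disjoint (fibreSpan p (unitVec x₀ (x + (J c : E)))) (fibreSpan p w) := by
  refine disjoint_fibreSpan hp.exists_fibre fun h => ?_
  have := baseChart_ne J hp hx c (x₀ := x₀)
  rw [baseChart_apply, coneExtension] at this
  exact this h

/-- **The chart is injective** (Hähl 2.1: `a ↦ U_a` is a bijection onto `S ∖ {U∞}`): if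
`x + J c` and `x + J c'` span the same fibre subspace then `J (c - c')` lies in it and in `W`, so is
`0`. [cite: Hahl1987, 2.1 and 2.9] -/
theorem baseChart_injective (hx : x ∉ fibreSpan p w) : Injective (baseChart p x₀ x J) := by
  intro c c' h
  rw [baseChart_apply, baseChart_apply,
    coneExtension_eq_iff hp.exists_fibre _ (add_frame_ne_zero J hx c)] at h
  -- `x + J c` and `x + J c'` lie in `V := V_{(x + J c')/‖…‖}`
  have h' : x + (J c' : E) ∈ fibreSpan p (unitVec x₀ (x + (J c' : E))) :=
    mem_fibreSpan_unitVec (add_frame_ne_zero J hx c')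
  have hdiff : ((J c : fibreSpan p w) : E) - (J c' : E) ∈
      fibreSpan p (unitVec x₀ (x + (J c' : E))) := by
    have := sub_mem h h'
    rwa [add_sub_add_left_eq_sub] at this
  have hW : ((J c : fibreSpan p w) : E) - (J c' : E) ∈ fibreSpan p w := sub_mem (J c).2 (J c').2
  have h0 := Submodule.disjoint_def.1 (disjoint_fibreSpan_unitVec_add J hp hx c') _ hdiff hW
  have : (J c : E) = (J c' : E) := sub_eq_zero.1 h0
  exact J.injective (Subtype.ext this)

/-- **The chart is onto the punctured base**: every `p y ≠ p w` is attained — `V_y` is a complement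
of `W`, so `x = v + u` with `v ∈ V_y`, `u ∈ W`, and `c := -J⁻¹ u` has `x + J c = v ∈ V_y ∖ 0`.
[cite: Hahl1987, 2.1 and 2.9] -/
theorem exists_baseChart_eq (hx : x ∉ fibreSpan p w) {y : sphere (0 : E) 1} (hy : p y ≠ p w) :
    ∃ c, baseChart p x₀ x J c = p y := by
  haveI := hp.finiteDimensional
  obtain ⟨v, hv, u, hu, hvu⟩ := exists_add_eq_of_ne hp.exists_fibre hp.finrank_eq hy x
  refine ⟨-J.symm ⟨u, hu⟩, ?_⟩
  have hxc : x + ((J (-J.symm ⟨u, hu⟩) : fibreSpan p w) : E) = v := by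
    rw [map_neg, J.apply_symm_apply, Submodule.coe_neg, Submodule.coe_mk, ← hvu]; abel
  rw [baseChart_apply, hxc]
  have hv0 : v ≠ 0 := by rw [← hxc]; exact add_frame_ne_zero J hx _
  exact coneExtension_eq_of_mem hp.exists_fibre hv0 hv

/-- The range of the chart is exactly the punctured base `M ∖ {p w}`. [cite: Hahl1987, 2.9] -/
theorem range_baseChart (hx : x ∉ fibreSpan p w) : range (baseChart p x₀ x J) = {p w}ᶜ := by
  ext m
  constructor
  · rintro ⟨c, rfl⟩
    exact baseChart_ne J hp hx c
  · intro hm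
    obtain ⟨y, rfl⟩ := hp.surjective m
    exact exists_baseChart_eq J hp hx hm

/-! ### The immersion property and the inverse function theorem -/

omit hp in
/-- The differential of the chart at `c`, read as an endomorphism of `ℝᵏ` (the tangent spaces of
`ℝᵏ` and of `M` in its charts are `ℝᵏ` by definition). [folklore] -/
def mfderivBaseChart (J : EuclideanSpace ℝ (Fin k) ≃L[ℝ] fibreSpan p w) (x : E)
    (c : EuclideanSpace ℝ (Fin k)) : EuclideanSpace ℝ (Fin k) →L[ℝ] EuclideanSpace ℝ (Fin k) :=
  mfderiv 𝓘(ℝ, EuclideanSpace ℝ (Fin k)) (𝓡 k) (baseChart p x₀ x J) c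

omit hp in
/-- Unfolding of `mfderivBaseChart`. [folklore] -/
theorem mfderivBaseChart_eq (x : E) (c : EuclideanSpace ℝ (Fin k)) :
    mfderivBaseChart (x₀ := x₀) J x c =
      mfderiv 𝓘(ℝ, EuclideanSpace ℝ (Fin k)) (𝓡 k) (baseChart p x₀ x J) c := rfl

variable [IsManifold (𝓡 k) ∞ M]

set_option backward.isDefEq.respectTransparency false in
/-- **The chart is an immersion**: `d(baseChart)_c` is injective for every `c`. By the chain rule
`d(baseChart)_c b = d𝒫_{x + J c} (J b)`; if this vanishes then `J b ∈ ker d𝒫 = V_{(x+Jc)/‖…‖}`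
(`mfderiv_coneExtension_apply_eq_zero_iff`), and `J b ∈ W`, so `J b = 0` (that fibre subspace is
not `W`). This is the transversality behind Hähl's 2.7/2.9. [cite: Hahl1987, 2.7 and 2.9] -/
theorem mfderiv_baseChart_injective (hx : x ∉ fibreSpan p w) (c : EuclideanSpace ℝ (Fin k)) :
    Injective (mfderiv 𝓘(ℝ, EuclideanSpace ℝ (Fin k)) (𝓡 k) (baseChart p x₀ x J) c) := by
  have hp1 : ContMDiff (𝓡 d) (𝓡 k) 1 p := hp.contMDiff.of_le (by exact_mod_cast le_top)
  set A : EuclideanSpace ℝ (Fin k) → E := fun c => x + ((J c : fibreSpan p w) : E) with hA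
  have h1 : MDifferentiableAt 𝓘(ℝ, E) (𝓡 k) (coneExtension p x₀) (A c) :=
    (contMDiffAt_coneExtension hp1 (add_frame_ne_zero J hx c)).mdifferentiableAt one_ne_zero
  have h2 : MDifferentiableAt 𝓘(ℝ, EuclideanSpace ℝ (Fin k)) 𝓘(ℝ, E) A c :=
    ((contDiff_const.add (((fibreSpan p w).subtypeL.comp J.toContinuousLinearMap).contDiff)).contMDiff
      (n := 1) c).mdifferentiableAt one_ne_zero
  have hcomp : mfderiv 𝓘(ℝ, EuclideanSpace ℝ (Fin k)) (𝓡 k) (baseChart p x₀ x J) c =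
      (mfderiv 𝓘(ℝ, E) (𝓡 k) (coneExtension p x₀) (A c)).comp
        (mfderiv 𝓘(ℝ, EuclideanSpace ℝ (Fin k)) 𝓘(ℝ, E) A c) :=
    mfderiv_comp c h1 h2
  rw [hcomp, hA, mfderiv_add_frame J x c]
  intro b b' hbb'
  have h0 : mfderiv 𝓘(ℝ, E) (𝓡 k) (coneExtension p x₀) (x + ((J c : fibreSpan p w) : E))
      (((J b : fibreSpan p w) : E) - (J b' : E)) = 0 := by
    rw [map_sub, sub_eq_zero]
    exact hbb'
  have hmem := mem_fibreSpan_of_mfderiv_coneExtension_eq_zero hp.exists_fibre hp.finrank_eq hp1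
    hp.mfderiv_surjective (add_frame_ne_zero J hx c) h0
  have hW : ((J b : fibreSpan p w) : E) - (J b' : E) ∈ fibreSpan p w := sub_mem (J b).2 (J b').2
  have := Submodule.disjoint_def.1 (disjoint_fibreSpan_unitVec_add J hp hx c) _ hmem hW
  exact J.injective (Subtype.ext (sub_eq_zero.1 this))

/-- The differential of the chart at `c`, an injective endomorphism of `ℝᵏ`, hence bijective, as a
continuous linear equivalence. [folklore] -/
def mfderivBaseChartEquiv (hx : x ∉ fibreSpan p w) (c : EuclideanSpace ℝ (Fin k)) :
    EuclideanSpace ℝ (Fin k) ≃L[ℝ] EuclideanSpace ℝ (Fin k) :=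
  (LinearEquiv.ofBijective (mfderivBaseChart (x₀ := x₀) J x c).toLinearMap
    ⟨mfderiv_baseChart_injective J hp hx c,
      LinearMap.surjective_of_injective (mfderiv_baseChart_injective J hp hx c)⟩).toContinuousLinearEquiv

/-- `mfderivBaseChartEquiv` is the differential of the chart. [folklore] -/
theorem coe_mfderivBaseChartEquiv (hx : x ∉ fibreSpan p w) (c : EuclideanSpace ℝ (Fin k)) :
    (mfderivBaseChartEquiv J hp hx c (x₀ := x₀) : EuclideanSpace ℝ (Fin k) →L[ℝ] EuclideanSpace ℝ (Fin k)) =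
      mfderiv 𝓘(ℝ, EuclideanSpace ℝ (Fin k)) (𝓡 k) (baseChart p x₀ x J) c := by
  ext v
  rfl

/-- **The chart is a local diffeomorphism at every point** (inverse function theorem on manifolds,
tree theorem `Literature.Geometry.Manifold.isLocalDiffeomorphAt_of_mfderiv`): Hähl 2.9, the affine
chart IS a chart of the smooth structure of the base. [cite: Hahl1987, 2.9] -/
theorem isLocalDiffeomorphAt_baseChart (hx : x ∉ fibreSpan p w) (c : EuclideanSpace ℝ (Fin k)) :
    IsLocalDiffeomorphAt 𝓘(ℝ, EuclideanSpace ℝ (Fin k)) (𝓡 k) ∞ (baseChart p x₀ x J) c :=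
  Literature.Geometry.Manifold.isLocalDiffeomorphAt_of_mfderiv (by simp) isOpen_univ (mem_univ c)
    (contMDiff_baseChart J hp.contMDiff hx).contMDiffOn (mfderivBaseChartEquiv J hp hx c)
    (coe_mfderivBaseChartEquiv J hp hx c).symm

/-- Hence the chart is a local diffeomorphism. [cite: Hahl1987, 2.9] -/
theorem isLocalDiffeomorph_baseChart (hx : x ∉ fibreSpan p w) :
    IsLocalDiffeomorph 𝓘(ℝ, EuclideanSpace ℝ (Fin k)) (𝓡 k) ∞ (baseChart p x₀ x J) :=
  fun c => isLocalDiffeomorphAt_baseChart J hp hx c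

/-- … and an open map; in particular `M ∖ {p w}` is the diffeomorphic image of `ℝᵏ`.
[cite: Hahl1987, 2.9] -/
theorem isOpenMap_baseChart (hx : x ∉ fibreSpan p w) : IsOpenMap (baseChart p x₀ x J) :=
  (isLocalDiffeomorph_baseChart J hp hx).isOpenMap

end WithHyp

end Literature.Geometry.Riemannian

end
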